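import Summits.QuantumFields.YangMills.Theorems.AlphaInputsT3ACv3Step
import HarnessLib

/-!
# `AlphaInputsT3ACv3StepW` — OWNER RULING g22-№5 §B1 (R-g18-a ADOPTED): THE (O) RESIDUAL ROW WITH PRINT'S `χ_k(proj h′)` RESTORED ON THE LEFT —
# `PinnedStep.Fibre55WinACw`, «displayed ⇒ windowed» `fibre55WinACw_of_fibre55WinAC`, and the (41)-induction `ineq41_pinned_windowed_ae_w` hypothesising
# ONLY the windowed row — lane `pub-balaban3d`, seat alpha-2 (g2); additive, registries untouched (`--supports stmt-QuantumFields-19936 --as helper`)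

WHY (OWNER RULING g22-№5 §A, `route-R3/ym/plan-g22/OWNER-RULING-g22-5.md` e051442924d0e9c4; ym-cruxidea-18916-2 g18 N-g18-1/2, sheet `NegationG18SelectionRobust.lean`
0f5180557d5146af; ★alpha-1 g7 consumer audit).  The displayed v3 residual row `PinnedStep.Fibre55WinAC k h′` (`AlphaInputsT3ACv3Step` :134) carries on the LEFT the bare pinned
mass `massP k (proj h′)`; at `proj h′ = triv_k` with `P_k(h′) ≠ ∅` that weight is `stepWeight·chiB·1` (`MassesPAC.massRecP_triv`) and bounds nothing off `P_k`, so the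
displayed row integrates `e^{−mainT_k(triv)}` over large fields where print's (49) carries `χ_k(h)` ((40) p.266) — an extensive excess over [Balaban1985UV3] (55) p.269.  The
(41)-induction `ineq41_pinned_windowed_ae` only ever USES the windowed left weight `wtP k (proj h′) = 𝟙[win]·massP` (its `hdirect`, v3Step :224–237, reached from the
displayed row through `hmono` :238–258).  THIS FILE (Phase B1, additive): §1 `Fibre55WinACw` = the row with `massP ↦ wtP` on the left (g18's sheet, verbatim); §2
`fibre55WinACw_of_fibre55WinAC` (displayed ⇒ windowed = the `hmono` block; g18's sheet, verbatim); §3 ★ `ineq41_pinned_windowed_ae_w` = v3Step's induction with the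
WINDOWED row as hypothesis (`hdirect` IS the row).  From today the (55)-row suppliers (NODE O ∕ Track A) target `Fibre55WinACw`; the stronger display is nobody's
obligation.  Phase B2 (the in-place swap of v3Step + WinRow (w1)) is the operator's on the owner's GO (W-g22-1).
HONEST FRAMING.  Hypothesis schemas and [folklore] measure theory; nothing of [B10]'s cluster expansion is asserted; count-neutral; nothing about d = 4, the continuum, or a
mass gap.

References: T. Bałaban, Commun. Math. Phys. 102 (1985) 255–275 [Balaban1985UV3] ((40)–(41) p.266, (47)–(49) pp.267–268, (55) p.269, (58) p.270).
-/

set_option autoImplicit false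

noncomputable section

namespace Summit.QuantumFields.YangMills.Theorems.PinnedStep

open MeasureTheory
open Literature.MathematicalPhysics.QuantumFieldTheory.Balaban1983to89
open Literature.MathematicalPhysics.QuantumFieldTheory.Balaban1983to89.AveragingRT (rnTransport rnTransport_nonneg)
open Literature.MathematicalPhysics.QuantumFieldTheory.Balaban1983to89.B10 (Ineq41)
open Literature.MathematicalPhysics.QuantumFieldTheory.Balaban1985CMP102
open Literature.MathematicalPhysics.QuantumFieldTheory.Balaban1985CMP102.Setting
open Summit.QuantumFields.Balaban3D.Carriers
open Summit.QuantumFields.Balaban3D.Proofs.Inputs (LaneConsts)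
open Summit.QuantumFields.Balaban3D.Proofs.ScalesArithmetic (gk_pos gk_le_one)
open Summit.QuantumFields.Balaban3D.Proofs.TowerAC
open Summit.QuantumFields.Balaban3D.Proofs.StandardAC
open Summit.QuantumFields.Balaban3D.Proofs.InputsAC
open Summit.QuantumFields.Balaban3D.Proofs.Bound55Masses (chiB chiB_nonneg chiB_le_one measurable_chiB measurable_stepWeight)
open Summit.QuantumFields.Balaban3D.Proofs.MassesPAC
open Summit.QuantumFields.Balaban3D.Proofs.TransportAC (integrable_mul_exp_of_le)
open Summit.QuantumFields.Balaban3D.Proofs.TransportDirectAC (transport41_le_sum_ae_direct)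
open Summit.QuantumFields.Balaban3D.Proofs.Transport48 (integrable_weight_mul rnTransport_mono_ae)
open Summit.QuantumFields.Balaban3D.Proofs (Bound55Std.measurable_actionEta Bound55Std.actionEta_nonneg)

variable {L : ℕ} (𝔎 : LaneConsts L) {S : Scales L} {G : Type} [GaugeGroup G] [MeasurableSpace G] [HaarData G]
  {E : Type} [NormedAddCommGroup E] [NormedSpace ℂ E]
  (X : ExternalInputsAC S G) (𝔖 : ∀ k, StepSeries S G E (nblkOf S 𝔎.carrier k) k)
  (win : (k : ℕ) → Hist S.P (k + 1) → Set (GaugeField S.P (k + 1) G))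

/-! ## §1 The windowed (55)-row (ym-cruxidea-18916-2 g18's sheet, verbatim) -/

/-- **THE WINDOWED (55)-ROW** — `PinnedStep.Fibre55WinAC k h′` with print's `χ_k(proj h′)` restored on the LEFT: the old history's weight is the WINDOWED
`wtP k (proj h′)` (`= 𝟙[win_{k−1}(proj h′)]·massP`, `wtP 0 = 1`) instead of the bare pinned mass `massP k (proj h′)`.  This is LITERALLY the `hdirect` that
`ineq41_pinned_windowed_ae` (v3Step :224–237) consumes. [cite: Balaban1985UV3, (40)–(41) p.266 + (49)–(55) pp.268–269 + (58) p.270] -/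
def Fibre55WinACw (k : ℕ) (h' : Hist S.P (k + 1)) : Prop :=
  (rnTransport (X.av k).avg (fun U =>
      stepWeight 𝔎.carrier.M₁ (rcolOf S 𝔎.carrier) (eps1Of S 𝔎.carrier) (epsSOf S 𝔎.carrier) k h' U *
        chiB 𝔎.carrier.M₁ (rcolOf S 𝔎.carrier) (eps1Of S 𝔎.carrier) k h' U *
        (wtP 𝔎 X win k h'.proj U *
          Real.exp (-((towerOfAC 𝔎 X 𝔖).mainT k h'.proj U) + (towerOfAC 𝔎 X 𝔖).Pint k h'.proj U - (towerOfAC 𝔎 X 𝔖).Ecst k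
            + (towerOfAC 𝔎 X 𝔖).Zterm k h'.proj + (towerOfAC 𝔎 X 𝔖).Rm k))))
    ≤ᵐ[fieldMeasure S.P (k + 1) G] fun V =>
      (win k h').indicator (fun _ => (1 : ℝ)) V * massP 𝔎 X (k + 1) h' V *
        Real.exp (-((towerOfAC 𝔎 X 𝔖).mainT (k + 1) h' V) - (towerOfAC 𝔎 X 𝔖).Ecst k
          + ((piecesAC 𝔎 X 𝔖 k).logσ₀ + (piecesAC 𝔎 X 𝔖 k).dg * Real.log ((towerOfAC 𝔎 X 𝔖).g k)) * (piecesAC 𝔎 X 𝔖 k).starB h'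
          + (piecesAC 𝔎 X 𝔖 k).logZU h' V + (piecesAC 𝔎 X 𝔖 k).Pold h' V
          + (towerOfAC 𝔎 X 𝔖).Zterm k ((piecesAC 𝔎 X 𝔖 k).proj h') + (towerOfAC 𝔎 X 𝔖).Rm k + (piecesAC 𝔎 X 𝔖 k).logFl h' V)

/-! ## §2 Displayed ⇒ windowed (the `hmono` block of v3Step; g18's sheet, verbatim) -/

variable [RegularGaugeGroup G]

omit [RegularGaugeGroup G] in
/-- **THE DISPLAYED ROW IMPLIES THE WINDOWED ROW** — after R-g18-a Phase B2 (OWNER RULING g23-№1 §A) `Fibre55WinAC` carries print's `χ_k(proj h′)` on the left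
itself, so the two rows have the SAME text and this is the identity (the integrability hypotheses of the Phase-B1 statement are kept, unused, so that the
signature's TYPE is unchanged for callers). [cite: Balaban1985UV3, (48)–(49) p.268] -/
theorem fibre55WinACw_of_fibre55WinAC (k : ℕ) (h' : Hist S.P (k + 1))
    (_hintW : Integrable (fun U => wtP 𝔎 X win k h'.proj U * Real.exp (-((towerOfAC 𝔎 X 𝔖).mainT k h'.proj U)
      + (towerOfAC 𝔎 X 𝔖).Pint k h'.proj U - (towerOfAC 𝔎 X 𝔖).Ecst k + (towerOfAC 𝔎 X 𝔖).Zterm k h'.proj + (towerOfAC 𝔎 X 𝔖).Rm k))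
      (fieldMeasure S.P k G))
    (_hintM : Integrable (fun U => massP 𝔎 X k h'.proj U * Real.exp (-((towerOfAC 𝔎 X 𝔖).mainT k h'.proj U)
      + (towerOfAC 𝔎 X 𝔖).Pint k h'.proj U - (towerOfAC 𝔎 X 𝔖).Ecst k + (towerOfAC 𝔎 X 𝔖).Zterm k h'.proj + (towerOfAC 𝔎 X 𝔖).Rm k))
      (fieldMeasure S.P k G))
    (hrow : Fibre55WinAC 𝔎 X 𝔖 win k h') : Fibre55WinACw 𝔎 X 𝔖 win k h' := by
  -- after R-g18-a Phase B2 the two rows have the SAME body: nothing to weaken (the integrability hypotheses are kept for the callers' sake)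
  unfold Fibre55WinAC at hrow
  exact hrow

/-! ## §3 The (41)-induction hypothesising ONLY the windowed row -/

/-- **★ (41) WITH PRINT'S WINDOWED PINNED WEIGHTS, `dV`-A.E., AT EVERY LEVEL `j ≤ K`, GIVEN THE WINDOWED v3 ROWS `Fibre55WinACw`** — `ineq41_pinned_windowed_ae`
(v3Step) VERBATIM except that the fibre hypothesis of the DIRECT (48)–(49) step (`hdirect`) IS the windowed row (no `hmono` weakening from the bare-mass display):
for every `j ≤ K`, `ρ_j(V) ≤ Σ_h wtP_j(h, V)·exp(−mainT_j(h,V) + Pint_j(h,V) − E_j + Zterm_j(h) + Rm_j)` for `dV`-a.e. `V`.  With `fibre55WinACw_of_fibre55WinAC` it re-derives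
the displayed-row version. [cite: Balaban1985UV3, (41) p.266 + (48)–(49) pp.267–268 + (55) p.269] -/
theorem ineq41_pinned_windowed_ae_w (hwin : ∀ k h', MeasurableSet (win k h'))
    (hrow : ∀ k, k + 1 ≤ S.K → ∀ h' : Hist S.P (k + 1), Fibre55WinACw 𝔎 X 𝔖 win k h')
    (R : ∀ k, k + 1 ≤ S.K → Summit.QuantumFields.Balaban3D.Proofs.Thm2AC.StepResidualsAC 𝔎 X 𝔖 k)
    (hU : ∀ k, k + 1 ≤ S.K → ∀ h : Hist S.P k, Measurable (X.UkH k h))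
    (hPm : ∀ k, k + 1 ≤ S.K → ∀ h : Hist S.P k, Measurable ((inputOfAC 𝔎 X 𝔖).Pint k h))
    (hPb : ∀ k, k + 1 ≤ S.K → ∃ cP : ℝ, ∀ (h : Hist S.P k) (U : GaugeField S.P k G), (inputOfAC 𝔎 X 𝔖).Pint k h U ≤ cP) :
    ∀ j : ℕ, j ≤ S.K → ∀ᵐ V ∂(fieldMeasure S.P j G), (towerOfAC 𝔎 X 𝔖).ρ j V ≤
      ∑ h : Hist S.P j, wtP 𝔎 X win j h V *
        Real.exp (-((towerOfAC 𝔎 X 𝔖).mainT j h V) + (towerOfAC 𝔎 X 𝔖).Pint j h V - (towerOfAC 𝔎 X 𝔖).Ecst j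
          + (towerOfAC 𝔎 X 𝔖).Zterm j h + (towerOfAC 𝔎 X 𝔖).Rm j) := by
  classical
  intro j
  induction j with
  | zero =>
    intro _
    exact ae_of_all _ fun V => (Summit.QuantumFields.Balaban3D.Proofs.Thm2AC.step0_towerOfAC 𝔎 X 𝔖).1 V
  | succ j ih =>
    intro hj
    have ihj := ih (by omega)
    obtain ⟨cP, hcP⟩ := hPb j hj
    have hLS := Summit.QuantumFields.Balaban3D.Proofs.AlphaBound55.eps1Of_le_epsSOf j 𝔎.carrier 𝔎.F.b₀_nonneg 𝔎.F.p₀_pos.le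
      (show j ≤ S.K by omega)
    -- integrability of the level-`j` summands, for the weights `wtP` and for the masses `M`
    have hintW : ∀ h : Hist S.P j, Integrable (fun U => wtP 𝔎 X win j h U * Real.exp (-((towerOfAC 𝔎 X 𝔖).mainT j h U) + (towerOfAC 𝔎 X 𝔖).Pint j h U - (towerOfAC 𝔎 X 𝔖).Ecst j
            + (towerOfAC 𝔎 X 𝔖).Zterm j h + (towerOfAC 𝔎 X 𝔖).Rm j)) (fieldMeasure S.P j G) :=
      fun h => integrable_mul_exp41 𝔎 X 𝔖 j (hU j hj) (hPm j hj) cP hcP h (integrable_wtP_and_integral_le 𝔎 X win hwin j h).1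
    have hMaj_int : Integrable (fun U => ∑ h : Hist S.P j, wtP 𝔎 X win j h U * Real.exp (-((towerOfAC 𝔎 X 𝔖).mainT j h U) + (towerOfAC 𝔎 X 𝔖).Pint j h U - (towerOfAC 𝔎 X 𝔖).Ecst j
            + (towerOfAC 𝔎 X 𝔖).Zterm j h + (towerOfAC 𝔎 X 𝔖).Rm j)) (fieldMeasure S.P j G) := integrable_finsetSum _ fun h _ => hintW h
    have hMaj0 : ∀ U, 0 ≤ (fun U => ∑ h : Hist S.P j, wtP 𝔎 X win j h U * Real.exp (-((towerOfAC 𝔎 X 𝔖).mainT j h U) + (towerOfAC 𝔎 X 𝔖).Pint j h U - (towerOfAC 𝔎 X 𝔖).Ecst j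
            + (towerOfAC 𝔎 X 𝔖).Zterm j h + (towerOfAC 𝔎 X 𝔖).Rm j)) U := fun U =>
      Finset.sum_nonneg fun h _ => mul_nonneg (wtP_nonneg_le 𝔎 X win j h U).1 (Real.exp_pos _).le
    -- the a.e.-modified density `min ρ_j Maj`
    have hpin : (towerOfAC 𝔎 X 𝔖).ρ j = (towerWAC 𝔎 X 𝔖).rho j := (towerWAC 𝔎 X 𝔖).pin_rho j
    have hρ0 : ∀ U, 0 ≤ (towerOfAC 𝔎 X 𝔖).ρ j U := fun U => by
      rw [hpin]; exact run3_rho_nonneg ((inputOfAC 𝔎 X 𝔖).toRunInput fun _ => True) j U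
    have hρi : Integrable ((towerOfAC 𝔎 X 𝔖).ρ j) (fieldMeasure S.P j G) := by
      rw [hpin]; exact run3_rho_integrable ((inputOfAC 𝔎 X 𝔖).toRunInput fun _ => True) j
    have hρt0 : ∀ U, 0 ≤ (fun U => min ((towerOfAC 𝔎 X 𝔖).ρ j U) ((fun U => ∑ h : Hist S.P j, wtP 𝔎 X win j h U * Real.exp (-((towerOfAC 𝔎 X 𝔖).mainT j h U) + (towerOfAC 𝔎 X 𝔖).Pint j h U - (towerOfAC 𝔎 X 𝔖).Ecst j
            + (towerOfAC 𝔎 X 𝔖).Zterm j h + (towerOfAC 𝔎 X 𝔖).Rm j)) U)) U := fun U => le_min (hρ0 U) (hMaj0 U)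
    have hρt_ae : (towerOfAC 𝔎 X 𝔖).ρ j =ᵐ[fieldMeasure S.P j G] (fun U => min ((towerOfAC 𝔎 X 𝔖).ρ j U) ((fun U => ∑ h : Hist S.P j, wtP 𝔎 X win j h U * Real.exp (-((towerOfAC 𝔎 X 𝔖).mainT j h U) + (towerOfAC 𝔎 X 𝔖).Pint j h U - (towerOfAC 𝔎 X 𝔖).Ecst j
            + (towerOfAC 𝔎 X 𝔖).Zterm j h + (towerOfAC 𝔎 X 𝔖).Rm j)) U)) := by
      filter_upwards [ihj] with U hU
      exact (min_eq_left hU).symm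
    have hρti : Integrable (fun U => min ((towerOfAC 𝔎 X 𝔖).ρ j U) ((fun U => ∑ h : Hist S.P j, wtP 𝔎 X win j h U * Real.exp (-((towerOfAC 𝔎 X 𝔖).mainT j h U) + (towerOfAC 𝔎 X 𝔖).Pint j h U - (towerOfAC 𝔎 X 𝔖).Ecst j
            + (towerOfAC 𝔎 X 𝔖).Zterm j h + (towerOfAC 𝔎 X 𝔖).Rm j)) U)) (fieldMeasure S.P j G) := hρi.congr hρt_ae
    -- the DIRECT (48)–(49) step for the modified density
    have hdirect : ∀ h' : Hist S.P (j + 1),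
        (rnTransport (X.av j).avg (fun U =>
          stepWeight 𝔎.carrier.M₁ (rcolOf S 𝔎.carrier) (eps1Of S 𝔎.carrier) (epsSOf S 𝔎.carrier) j h' U *
            chiB 𝔎.carrier.M₁ (rcolOf S 𝔎.carrier) (eps1Of S 𝔎.carrier) j h' U *
            (wtP 𝔎 X win j h'.proj U * Real.exp (-((towerOfAC 𝔎 X 𝔖).mainT j h'.proj U) + (towerOfAC 𝔎 X 𝔖).Pint j h'.proj U - (towerOfAC 𝔎 X 𝔖).Ecst j
            + (towerOfAC 𝔎 X 𝔖).Zterm j h'.proj + (towerOfAC 𝔎 X 𝔖).Rm j))))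
        ≤ᵐ[fieldMeasure S.P (j + 1) G] fun V => massP 𝔎 X (j + 1) h' V *
          ((win j h').indicator (fun _ => (1 : ℝ)) V * Real.exp (-((towerOfAC 𝔎 X 𝔖).mainT (j + 1) h' V) - (towerOfAC 𝔎 X 𝔖).Ecst j
              + ((piecesAC 𝔎 X 𝔖 j).logσ₀ + (piecesAC 𝔎 X 𝔖 j).dg * Real.log ((towerOfAC 𝔎 X 𝔖).g j)) * (piecesAC 𝔎 X 𝔖 j).starB h'
              + (piecesAC 𝔎 X 𝔖 j).logZU h' V + (piecesAC 𝔎 X 𝔖 j).Pold h' V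
              + (towerOfAC 𝔎 X 𝔖).Zterm j ((piecesAC 𝔎 X 𝔖 j).proj h') + (towerOfAC 𝔎 X 𝔖).Rm j + (piecesAC 𝔎 X 𝔖 j).logFl h' V)) := by
      intro h'
      filter_upwards [hrow j hj h'] with V h2
      exact h2.trans (le_of_eq (by ring))
    have hstep := transport41_le_sum_ae_direct (X.av_ac j) (Hist.proj (P := S.P) (k := j)) (fun U => min ((towerOfAC 𝔎 X 𝔖).ρ j U) ((fun U => ∑ h : Hist S.P j, wtP 𝔎 X win j h U * Real.exp (-((towerOfAC 𝔎 X 𝔖).mainT j h U) + (towerOfAC 𝔎 X 𝔖).Pint j h U - (towerOfAC 𝔎 X 𝔖).Ecst j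
            + (towerOfAC 𝔎 X 𝔖).Zterm j h + (towerOfAC 𝔎 X 𝔖).Rm j)) U)) hρti
      (wtP 𝔎 X win j) (fun h U => (-((towerOfAC 𝔎 X 𝔖).mainT j h U) + (towerOfAC 𝔎 X 𝔖).Pint j h U - (towerOfAC 𝔎 X 𝔖).Ecst j
            + (towerOfAC 𝔎 X 𝔖).Zterm j h + (towerOfAC 𝔎 X 𝔖).Rm j))
      (stepWeight 𝔎.carrier.M₁ (rcolOf S 𝔎.carrier) (eps1Of S 𝔎.carrier) (epsSOf S 𝔎.carrier) j)
      (chiB 𝔎.carrier.M₁ (rcolOf S 𝔎.carrier) (eps1Of S 𝔎.carrier) j)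
      (massP 𝔎 X (j + 1))
      (fun h' V => (win j h').indicator (fun _ => (1 : ℝ)) V * Real.exp (-((towerOfAC 𝔎 X 𝔖).mainT (j + 1) h' V) - (towerOfAC 𝔎 X 𝔖).Ecst j
              + ((piecesAC 𝔎 X 𝔖 j).logσ₀ + (piecesAC 𝔎 X 𝔖 j).dg * Real.log ((towerOfAC 𝔎 X 𝔖).g j)) * (piecesAC 𝔎 X 𝔖 j).starB h'
              + (piecesAC 𝔎 X 𝔖 j).logZU h' V + (piecesAC 𝔎 X 𝔖 j).Pold h' V
              + (towerOfAC 𝔎 X 𝔖).Zterm j ((piecesAC 𝔎 X 𝔖 j).proj h') + (towerOfAC 𝔎 X 𝔖).Rm j + (piecesAC 𝔎 X 𝔖 j).logFl h' V))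
      (fun U => min_le_right _ _) hintW (fun h U => (wtP_nonneg_le 𝔎 X win j h U).1)
      (measurable_stepWeight _ _ _ _ j) (stepWeight_nonneg _ _ _ _ j) (stepWeight_le_one _ _ _ _ j)
      (measurable_chiB _ _ _ j) (chiB_nonneg _ _ _ j) (chiB_le_one _ _ _ j)
      (fun h U hne => massRecP_cover _ _ _ _ _ j hLS h U (fun h0 => hne (le_antisymm
        (h0 ▸ (wtP_nonneg_le 𝔎 X win j h U).2) (wtP_nonneg_le 𝔎 X win j h U).1)))
      hdirect
    -- the honesty of the version selection: `ρ_(j+1) = T_j ρ_j = T_j (min ρ_j Maj)` a.e.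
    have hρT : ∀ᵐ V ∂(fieldMeasure S.P (j + 1) G), (towerOfAC 𝔎 X 𝔖).ρ (j + 1) V = rnTransport (X.av j).avg (fun U => min ((towerOfAC 𝔎 X 𝔖).ρ j U) ((fun U => ∑ h : Hist S.P j, wtP 𝔎 X win j h U * Real.exp (-((towerOfAC 𝔎 X 𝔖).mainT j h U) + (towerOfAC 𝔎 X 𝔖).Pint j h U - (towerOfAC 𝔎 X 𝔖).Ecst j
            + (towerOfAC 𝔎 X 𝔖).Zterm j h + (towerOfAC 𝔎 X 𝔖).Rm j)) U)) V := by
      have hW : (towerWAC 𝔎 X 𝔖).rho j =ᵐ[fieldMeasure S.P j G] (fun U => min ((towerOfAC 𝔎 X 𝔖).ρ j U) ((fun U => ∑ h : Hist S.P j, wtP 𝔎 X win j h U * Real.exp (-((towerOfAC 𝔎 X 𝔖).mainT j h U) + (towerOfAC 𝔎 X 𝔖).Pint j h U - (towerOfAC 𝔎 X 𝔖).Ecst j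
            + (towerOfAC 𝔎 X 𝔖).Zterm j h + (towerOfAC 𝔎 X 𝔖).Rm j)) U)) := by
        rw [← hpin]
        exact hρt_ae
      have hcongr : rnTransport (X.av j).avg ((towerWAC 𝔎 X 𝔖).rho j) = rnTransport (X.av j).avg (fun U => min ((towerOfAC 𝔎 X 𝔖).ρ j U) ((fun U => ∑ h : Hist S.P j, wtP 𝔎 X win j h U * Real.exp (-((towerOfAC 𝔎 X 𝔖).mainT j h U) + (towerOfAC 𝔎 X 𝔖).Pint j h U - (towerOfAC 𝔎 X 𝔖).Ecst j
            + (towerOfAC 𝔎 X 𝔖).Zterm j h + (towerOfAC 𝔎 X 𝔖).Rm j)) U)) :=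
        rnTransport_congr_ae hW (fun U => run3_rho_nonneg ((inputOfAC 𝔎 X 𝔖).toRunInput fun _ => True) j U) hρt0
      filter_upwards [run3_rho_succ_ae_eq_rn ((inputOfAC 𝔎 X 𝔖).toRunInput fun _ => True) j] with V hV
      rw [← hcongr]
      exact (congrFun ((towerWAC 𝔎 X 𝔖).pin_rho (j + 1)) V).trans hV
    -- exponent bookkeeping
    have hexp := RepAtHeightsAdapter.expo5558_le_expo41_succ
      (Summit.QuantumFields.Balaban3D.Proofs.Thm2AC.stepLeavesOfAC j hj (R j hj)) hj (gk_pos S j) (gk_le_one S S.gK_le_one j (by omega))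
    filter_upwards [hstep, hρT] with V hV hρV
    rw [hρV]
    refine hV.trans (Finset.sum_le_sum fun h' _ => ?_)
    rw [wtP_succ]
    have hM0 := massRecP_nonneg 𝔎.carrier.M₁ (rcolOf S 𝔎.carrier) (eps1Of S 𝔎.carrier) (epsSOf S 𝔎.carrier) X.av (j + 1) h' V
    have hi0 : 0 ≤ (win j h').indicator (fun _ => (1 : ℝ)) V := Set.indicator_nonneg (fun _ _ => zero_le_one) V
    have key : ∀ {m i x y : ℝ}, 0 ≤ m → 0 ≤ i → x ≤ y → m * (i * x) ≤ i * m * y := by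
      intro m i x y hm hi hxy
      calc m * (i * x) = i * m * x := by ring
        _ ≤ i * m * y := mul_le_mul_of_nonneg_left hxy (mul_nonneg hi hm)
    exact key hM0 hi0 (Real.exp_le_exp.mpr (hexp h' V))

end Summit.QuantumFields.YangMills.Theorems.PinnedStep

end
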